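import Mathlib
import HarnessLib

/-!
# `MatrixDescartes` census — rank-one `(2,4)₁`: the THREE-LETTER curvature form, its orbit derivative and the
# ORBIT-TANGENCY RESULTANT with its palindromic sign structure (algebraic heart of «Z(κ₃) ≤ 4»)

HONEST FRAMING.  Object-search cell `pub-symmetroid`, seat `val-sym-mdr-p1` (generation 20); helper file `--supports` the crux item
stmt-ValiantsHypothesis-18050 (`Theses.LacunarySymmetroid.MatrixDescartes`, OPEN, on HOLD) with NO closure claim.  Pure ring identities
(no analysis) behind the seat's paper theorem «THREE-LETTER CURVATURE LAW» (memo CURVATURE.md §6c); nothing here bears on `MatrixDescartes`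
in its window, on `DoorA26` / `DoorA34`, registers / credences, or `VP ≠ VNP`.

SETTING (`…PivotResolventCurvature`, `…PivotRankOneCurvature`).  For three one-sided rank-one letters with rates `−a < 0 < b₁ < b₂`,
`b₁ < a < b₂`, the curvature Wronskian `𝒦` of the lineage is, after the normalisation `y₀ = 1`, `P = y₁/y₀`, `Q = y₂/y₀`, the cubic
  `g(P,Q) = αP(1+P) − βQ(1+Q) + PQ(δ + γ(P+Q))`,  `α = σ₀₁(a−b₁)ab₁ > 0`, `β = σ₀₂(b₂−a)ab₂ > 0`, `γ = σ₁₂(b₁+b₂)b₁b₂ > 0`, `δ ∈ ℝ`,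
evaluated along the orbit `Q = cP^ρ`, `ρ = (a+b₂)/(a+b₁) > 1`; sign changes of `𝒦` = crossings of the orbit with `{g = 0}`.  The orbits are the
level sets of `v = log Q − ρ log P`, so the crossings of ONE orbit are bounded by `1 +` the number of critical points of `v` on the real locus
`{g = 0}`, which are the common zeros of `g` and its ORBIT DERIVATIVE `(P∂_P + ρQ∂_Q)g`.
§1 `threeLetter_orbitDerivative`: `P·g_P + ρQ·g_Q = G + (1+2ρ)·g` with `G = βQ² + [(1+ρ)β − ρδP − (ρ−1)γP²]Q − αP(2ρ + (2ρ−1)P)` — on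
`{g = 0}` the orbit derivative is a quadratic in `Q` with ONE positive root.
§2 `threeLetter_resultant_expansion`: the Sylvester resultant `Res_Q(g, G)` (both quadratics in `Q`) is `P·(sextic)` with the PALINDROMIC-
ANTIPALINDROMIC sign structure `c₁ = αβ³ρ(ρ−1)`, `c₂ = αβ²X`, `c₃ = αβY`, `c₅ = −αγY`, `c₆ = αγ²X`, `c₇ = −αγ³ρ(ρ−1)` (`X, Y, c₄` explicit):
the coefficient sign word is `(+, x, y, ∗, −y, x, −)`, which has EXACTLY three sign changes for every `x, y, ∗` — so by Descartes `v` has at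
most three critical points on `{g = 0}`, and an orbit meets the locus at most four times (memo §6c supplies the one-arc/oval bookkeeping).
§3 `threeLetter_resultant_common_root`: a common root `q` of `g(P,·)` and `G(P,·)` forces `Res(P) = 0` (explicit Bézout cofactors).
The analytic wrapper (critical points ↔ tangency, topology of the real locus) is NOT in this file.

[folklore] Sylvester resultant of two quadratics and its Bézout cofactors; `ring` / `linear_combination`.  No definitions, no named facts.
-/

-- `Summit.ValiantsHypothesis.ValiantsHypothesis.…` repeats a component by the D-0017 layout
-- (single-conjunct summit), which the `dupNamespace` linter flags; the name is mandated.
set_option linter.dupNamespace false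

namespace Summit.ValiantsHypothesis.ValiantsHypothesis.Theorems.LacunarySymmetroidMatrixDescartes.Pivot.Resolvent

/-! ## 1. The orbit derivative of the three-letter curvature form -/

/-- **ORBIT DERIVATIVE.**  With `g = αP(1+P) − βQ(1+Q) + PQ(δ + γ(P+Q))`, `g_P = α(1+2P) + δQ + 2γPQ + γQ²`, `g_Q = −β(1+2Q) + δP + γP² + 2γPQ`
(the partial derivatives) and `G = βQ² + ((1+ρ)β − ρδP − (ρ−1)γP²)Q − αP(2ρ + (2ρ−1)P)`:  `P·g_P + ρQ·g_Q = G + (1+2ρ)·g`.  So ON the curve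
`g = 0` the derivative of `g` along the torus orbits `(P, cP^ρ)` is the quadratic `G`, whose coefficients in `Q` are `β > 0`, anything, `< 0`
(one positive root). [folklore: computation] -/
theorem threeLetter_orbitDerivative (α β γ δ ρ P Q : ℝ) :
    P * (α * (1 + 2 * P) + δ * Q + 2 * γ * P * Q + γ * Q ^ 2) + ρ * Q * (-β * (1 + 2 * Q) + δ * P + γ * P ^ 2 + 2 * γ * P * Q)
      = (β * Q ^ 2 + ((1 + ρ) * β - ρ * δ * P - (ρ - 1) * γ * P ^ 2) * Q - α * P * (2 * ρ + (2 * ρ - 1) * P))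
        + (1 + 2 * ρ) * (α * P * (1 + P) - β * Q * (1 + Q) + P * Q * (δ + γ * (P + Q))) := by
  ring

/-! ## 2. The orbit-tangency resultant and its sign structure -/

/-- **THE ORBIT-TANGENCY RESULTANT.**  Write `g = c₂Q² + bQ + a` and `G = βQ² + g₁Q + g₀` as quadratics in `Q`
(`a = αP(1+P)`, `b = −β + δP + γP²`, `c₂ = γP − β`, `g₁ = (1+ρ)β − ρδP − (ρ−1)γP²`, `g₀ = −αP(2ρ + (2ρ−1)P)`).  Their Sylvester resultant
`(c₂g₀ − βa)² − (c₂g₁ − βb)(bg₀ − ag₁)` equals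
`αβ³ρ(ρ−1)·P + αβ²X·P² + αβY·P³ + c₄·P⁴ − αγY·P⁵ + αγ²X·P⁶ − αγ³ρ(ρ−1)·P⁷` with
`X = α(2ρ−1)² − βρ(2−ρ) − γ(ρ²−1) − δ(2ρ²−2ρ+1)`, `Y = δ²ρ(ρ−1) + 2γδρ² − 2βδ(ρ−1)² − 3βγρ(ρ−1) − 4αγρ(2ρ−1) + 4αβ(ρ−1)(2ρ−1)` and an
explicit `c₄`.  READING: for `α, β, γ > 0`, `ρ > 1` the coefficient signs are `(+, x, y, ∗, −y, x, −)` — exactly THREE sign changes whatever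
`x, y, ∗` — so (Descartes) at most three positive `P` carry a tangency of an orbit with `{g = 0}`. [this file; found with exact rational arithmetic] -/
theorem threeLetter_resultant_expansion (α β γ δ ρ P : ℝ) :
    ((γ * P - β) * (-α * P * (2 * ρ + (2 * ρ - 1) * P)) - β * (α * P * (1 + P))) ^ 2
      - ((γ * P - β) * ((1 + ρ) * β - ρ * δ * P - (ρ - 1) * γ * P ^ 2) - β * (-β + δ * P + γ * P ^ 2))
        * ((-β + δ * P + γ * P ^ 2) * (-α * P * (2 * ρ + (2 * ρ - 1) * P)) - (α * P * (1 + P)) * ((1 + ρ) * β - ρ * δ * P - (ρ - 1) * γ * P ^ 2))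
      = α * β ^ 3 * ρ * (ρ - 1) * P
        + α * β ^ 2 * (α * (2 * ρ - 1) ^ 2 - β * ρ * (2 - ρ) - γ * (ρ ^ 2 - 1) - δ * (2 * ρ ^ 2 - 2 * ρ + 1)) * P ^ 2
        + α * β * (δ ^ 2 * ρ * (ρ - 1) + 2 * γ * δ * ρ ^ 2 - 2 * β * δ * (ρ - 1) ^ 2 - 3 * β * γ * ρ * (ρ - 1) - 4 * α * γ * ρ * (2 * ρ - 1)
            + 4 * α * β * (ρ - 1) * (2 * ρ - 1)) * P ^ 3
        + (- α * γ * δ ^ 2 * ρ ^ 2 + α * β * δ ^ 2 - 2 * α * β * δ ^ 2 * ρ + α * β * δ ^ 2 * ρ ^ 2 - 2 * α * β * γ * δ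
            - 4 * α * β * γ * δ * ρ + 4 * α * β * γ * δ * ρ ^ 2 + 2 * α * β * γ ^ 2 + 2 * α * β * γ ^ 2 * ρ ^ 2 - 4 * α * β ^ 2 * γ
            + 4 * α * β ^ 2 * γ * ρ - 2 * α * β ^ 2 * γ * ρ ^ 2 + 4 * α ^ 2 * γ ^ 2 * ρ ^ 2 - 2 * α ^ 2 * β * γ + 16 * α ^ 2 * β * γ * ρ
            - 16 * α ^ 2 * β * γ * ρ ^ 2 + 4 * α ^ 2 * β ^ 2 - 8 * α ^ 2 * β ^ 2 * ρ + 4 * α ^ 2 * β ^ 2 * ρ ^ 2) * P ^ 4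
        - α * γ * (δ ^ 2 * ρ * (ρ - 1) + 2 * γ * δ * ρ ^ 2 - 2 * β * δ * (ρ - 1) ^ 2 - 3 * β * γ * ρ * (ρ - 1) - 4 * α * γ * ρ * (2 * ρ - 1)
            + 4 * α * β * (ρ - 1) * (2 * ρ - 1)) * P ^ 5
        + α * γ ^ 2 * (α * (2 * ρ - 1) ^ 2 - β * ρ * (2 - ρ) - γ * (ρ ^ 2 - 1) - δ * (2 * ρ ^ 2 - 2 * ρ + 1)) * P ^ 6
        - α * γ ^ 3 * ρ * (ρ - 1) * P ^ 7 := by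
  ring

/-- The END coefficients have fixed signs: `αβ³ρ(ρ−1) > 0` and `−αγ³ρ(ρ−1) < 0` for `α, β, γ > 0`, `ρ > 1` (the middle pairs `(c₂, c₆)` and
`(c₃, c₅)` are proportional with positive factors `β² : γ²` resp. opposite signs `β : −γ`, visible in `threeLetter_resultant_expansion`).
[this file] -/
theorem threeLetter_resultant_endSigns (α β γ ρ : ℝ) (hα : 0 < α) (hβ : 0 < β) (hγ : 0 < γ) (hρ : 1 < ρ) :
    0 < α * β ^ 3 * ρ * (ρ - 1) ∧ -(α * γ ^ 3 * ρ * (ρ - 1)) < 0 := by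
  have hρ0 : 0 < ρ := by linarith
  have hρ1 : 0 < ρ - 1 := by linarith
  constructor
  · positivity
  · have : 0 < α * γ ^ 3 * ρ * (ρ - 1) := by positivity
    linarith

/-! ## 3. Common roots kill the resultant (explicit Bézout cofactors) -/

/-- **COMMON ROOT ⇒ RESULTANT VANISHES** for two quadratics `f = f₂q² + f₁q + f₀`, `h = h₂q² + h₁q + h₀`:
`(f₂h₀ − h₂f₀)² − (f₂h₁ − h₂f₁)(f₁h₀ − f₀h₁) = U·f(q) + V·h(q)` with `U = (M − Lq)h₂ − Lh₁`, `V = −(M − Lq)f₂ + Lf₁`, `M = h₂f₀ − f₂h₀`,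
`L = h₂f₁ − f₂h₁`. [folklore] -/
theorem quadratic_resultant_eq_zero_of_common_root (f₂ f₁ f₀ h₂ h₁ h₀ q : ℝ) (hf : f₂ * q ^ 2 + f₁ * q + f₀ = 0)
    (hh : h₂ * q ^ 2 + h₁ * q + h₀ = 0) :
    (f₂ * h₀ - h₂ * f₀) ^ 2 - (f₂ * h₁ - h₂ * f₁) * (f₁ * h₀ - f₀ * h₁) = 0 := by
  linear_combination (((h₂ * f₀ - f₂ * h₀) - (h₂ * f₁ - f₂ * h₁) * q) * h₂ - (h₂ * f₁ - f₂ * h₁) * h₁) * hf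
    + (-((h₂ * f₀ - f₂ * h₀) - (h₂ * f₁ - f₂ * h₁) * q) * f₂ + (h₂ * f₁ - f₂ * h₁) * f₁) * hh

/-- **Three-letter instance.**  If `q` is a common root of `g(P,·)` and `G(P,·)` then the orbit-tangency resultant vanishes at `P`; with
`threeLetter_resultant_expansion` the positive `P` carrying an orbit tangency of `{g = 0}` are roots of the degree-7 polynomial displayed there.
[this file] -/
theorem threeLetter_resultant_common_root (α β γ δ ρ P q : ℝ)
    (hg : (γ * P - β) * q ^ 2 + (-β + δ * P + γ * P ^ 2) * q + α * P * (1 + P) = 0)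
    (hG : β * q ^ 2 + ((1 + ρ) * β - ρ * δ * P - (ρ - 1) * γ * P ^ 2) * q + (-α * P * (2 * ρ + (2 * ρ - 1) * P)) = 0) :
    α * β ^ 3 * ρ * (ρ - 1) * P
        + α * β ^ 2 * (α * (2 * ρ - 1) ^ 2 - β * ρ * (2 - ρ) - γ * (ρ ^ 2 - 1) - δ * (2 * ρ ^ 2 - 2 * ρ + 1)) * P ^ 2
        + α * β * (δ ^ 2 * ρ * (ρ - 1) + 2 * γ * δ * ρ ^ 2 - 2 * β * δ * (ρ - 1) ^ 2 - 3 * β * γ * ρ * (ρ - 1) - 4 * α * γ * ρ * (2 * ρ - 1)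
            + 4 * α * β * (ρ - 1) * (2 * ρ - 1)) * P ^ 3
        + (- α * γ * δ ^ 2 * ρ ^ 2 + α * β * δ ^ 2 - 2 * α * β * δ ^ 2 * ρ + α * β * δ ^ 2 * ρ ^ 2 - 2 * α * β * γ * δ
            - 4 * α * β * γ * δ * ρ + 4 * α * β * γ * δ * ρ ^ 2 + 2 * α * β * γ ^ 2 + 2 * α * β * γ ^ 2 * ρ ^ 2 - 4 * α * β ^ 2 * γ
            + 4 * α * β ^ 2 * γ * ρ - 2 * α * β ^ 2 * γ * ρ ^ 2 + 4 * α ^ 2 * γ ^ 2 * ρ ^ 2 - 2 * α ^ 2 * β * γ + 16 * α ^ 2 * β * γ * ρ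
            - 16 * α ^ 2 * β * γ * ρ ^ 2 + 4 * α ^ 2 * β ^ 2 - 8 * α ^ 2 * β ^ 2 * ρ + 4 * α ^ 2 * β ^ 2 * ρ ^ 2) * P ^ 4
        - α * γ * (δ ^ 2 * ρ * (ρ - 1) + 2 * γ * δ * ρ ^ 2 - 2 * β * δ * (ρ - 1) ^ 2 - 3 * β * γ * ρ * (ρ - 1) - 4 * α * γ * ρ * (2 * ρ - 1)
            + 4 * α * β * (ρ - 1) * (2 * ρ - 1)) * P ^ 5
        + α * γ ^ 2 * (α * (2 * ρ - 1) ^ 2 - β * ρ * (2 - ρ) - γ * (ρ ^ 2 - 1) - δ * (2 * ρ ^ 2 - 2 * ρ + 1)) * P ^ 6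
        - α * γ ^ 3 * ρ * (ρ - 1) * P ^ 7 = 0 := by
  rw [← threeLetter_resultant_expansion]
  exact quadratic_resultant_eq_zero_of_common_root (γ * P - β) (-β + δ * P + γ * P ^ 2) (α * P * (1 + P)) β
    ((1 + ρ) * β - ρ * δ * P - (ρ - 1) * γ * P ^ 2) (-α * P * (2 * ρ + (2 * ρ - 1) * P)) q hg hG

end Summit.ValiantsHypothesis.ValiantsHypothesis.Theorems.LacunarySymmetroidMatrixDescartes.Pivot.Resolvent
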